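import Summits.QuantumFields.YangMills.Theorems.AllWindowsColdBoxBoxHighLineSmearedFPWeight
import Literature.MathematicalPhysics.QuantumFieldTheory.Balaban1983to89.B10Eq18SigmaSU2Haar
import Literature.Probability.LatticeModels.DirichletGreenFunction

/-!
# TASK T-S5/U5 step (1b), brick T-S5.4c: the LINEARISED FADDEEV–POPOV OPERATOR `fpOperator H U` (definitions + algebra)

Planner ym-idea-2 g17, T-S5.4 bricks (2026-08-29T17:01:45Z; `Cruxes/BoxWindowHighSU2213/STUB-PLAN-S5U5-STEP1.md` 9448383ae86e, T-S5.4b typed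
in `TaskS5Pauli.lean` 5326f89b3a85): the orbit average `N_h(U) = ∫ h(U^{ext k}) dk` of the smeared gauge fixing (✓T-S5.1 `smearedFPIdentity`,
✓T-S5.2 `fpWeight`, ✓T-S5.3 orbit localisation) is computed in PAULI COORDINATES `k_x = expPauli (A x) = exp(iΣ_a A^a_x σ_a)`
(✓`B10Eq18SigmaSU2Haar.expPauli`, T-S5.4b `OrbitAveragePauli`).  This file types the LINEARISATION of the divergence defect
`divDefect (U^{exp iA}) x` (✓T-S5.2) in `A` — the lattice Faddeev–Popov operator — and proves its algebra:

* `pauliLinkLin U a e = X_{e₋}·U_e − U_e·X_{e₊}`, `X_z = su2Coord (a z)` — the first variation of the link `(U^{exp iA})_e = e^{X_{e₋}} U_e e^{−X_{e₊}}`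
  for a site field `a : ℤ⁴ → ℝ³`;
* `divDefectLin U a x = Σ_μ (imVecM (pauliLinkLin U a (x−e_μ,μ)) − imVecM (pauliLinkLin U a (x,μ))) : ℝ³` — the first variation of
  `divDefect`; ℝ-LINEAR in `a` (`divDefectLin_add`, `divDefectLin_smul`, `divDefectLin_zero`);
* `extPauli H A` — zero extension of interior Pauli coordinates `A : interiorSites H → ℝ³` (so that `extendGauge H (expPauli ∘ A) = expPauli ∘ extPauli H A`,
  `extendGauge_expPauli`); `vecToField H v` — the coordinate vector `v : interiorSites H × Fin 3 → ℝ` as a field;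
* **`fpLinear H U`** — the linear map `v ↦ (x,c) ↦ divDefectLin U (extPauli H (vecToField H v)) x c` on `ℝ^{interiorSites × 3}`, and
  **`fpOperator H U := LinearMap.toMatrix' (fpLinear H U)`**, `fpOperator_mulVec`;
* the FLAT POINT: `imVecM_su2Coord : imVecM (su2Coord v) = pauliPerm *ᵥ v` (`pauliPerm = !![0,0,1;0,−1,0;1,0,0]`, the dictionary between
  print's Pauli coordinates and the line's `imVec`), `divDefectLin_one : divDefectLin 1 a x = pauliPerm *ᵥ (b ↦ Δ_{ℤ⁴}(a·b)(x))`
  (✓`latticeLaplacianZd`), and **`fpOperator_one : fpOperator H 1 = −(dirichletMatrix (interiorSites H) ⊗ₖ pauliPerm)`** — minus the tree's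
  Dirichlet Laplacian matrix of the interior box (✓`dirichletMatrix`, ✓`mulVec_dirichletMatrix`; = ✓GaugeGram's `gradVec` Gram matrix)
  tensor the coordinate dictionary; hence `abs_det_fpOperator_one : |det (fpOperator H 1)| = |det (dirichletMatrix (interiorSites H))| ^ 3` and
  `det_fpOperator_one_ne_zero` (✓`mulVec_dirichletMatrix_injective`).

The second-order REMAINDER `|divDefect (U^{exp iA}) x − divDefect U x − divDefectLin U a x| ≤ C·‖a‖²_{∞,nbhd(x)}` is the next file
(T-S5.4c, analytic half).  HONEST LABEL: definitions + algebra of ONE brick of step (1b) of the XL stubs S5/U5; T-S5.4 proper, S5, U5,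
⟨24004⟩ ⟨24335⟩ ⟨24336⟩ remain OPEN; no crux, rung or summit is proved; the Yang–Mills mass gap is NOT proved by this file.
-/

set_option autoImplicit false

noncomputable section

open Matrix Finset
open scoped Kronecker
open Literature.MathematicalPhysics.QuantumFieldTheory.Balaban1983to89.B10Eq18SigmaSU2 (su2Coord)
open Literature.MathematicalPhysics.QuantumFieldTheory.Balaban1983to89.B10Eq18SigmaSU2Haar (expPauli coe_expPauli exp_su2Coord expPauli_zero)
open Literature.MathematicalPhysics.QuantumLattice (LGConfig ZdEdge gaugeTransformZd)
open Literature.Probability.LatticeModels (Site latticeLaplacianZd dirichletMatrix zeroExtend mulVec_dirichletMatrix)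

namespace Summit.QuantumFields.YangMills.Theorems.AllWindowsColdBoxBoxHighLine

/-! ## The dictionary `imVecM ∘ su2Coord`

Linearity of `su2Coord` (`su2Coord_add/_smul/_zero/_sub`) is in the tree (`B10Eq18SigmaSU2Chart`, `B10Eq18SigmaSU2Window`, whose oleans are
not served at the time of writing); it is used below only through local `have`s (entrywise `fin_cases`), never restated. -/

/-- `imVecM` commutes with real scalars. -/
theorem imVecM_smul (r : ℝ) (X : Matrix (Fin 2) (Fin 2) ℂ) : imVecM (r • X) = r • imVecM X := by
  ext c
  fin_cases c <;> simp [imVecM, Complex.real_smul]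

/-- `imVecM 0 = 0`. -/
theorem imVecM_zero : imVecM (0 : Matrix (Fin 2) (Fin 2) ℂ) = 0 := by
  ext c
  fin_cases c <;> simp [imVecM]

/-- The coordinate dictionary between print's Pauli coordinates and the line's `imVec`: `(v₀,v₁,v₂) ↦ (v₂, −v₁, v₀)`. -/
def pauliPerm : Matrix (Fin 3) (Fin 3) ℝ := !![0, 0, 1; 0, -1, 0; 1, 0, 0]

/-- **`imVecM (su2Coord v) = pauliPerm *ᵥ v`**: the su(2)-coordinates of `iΣ_a v_a σ_a` are `(v₂, −v₁, v₀)`. -/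
theorem imVecM_su2Coord (v : Fin 3 → ℝ) : imVecM (su2Coord v) = pauliPerm *ᵥ v := by
  ext c
  fin_cases c <;> simp [imVecM, su2Coord, pauliPerm, Matrix.mulVec, dotProduct, Fin.sum_univ_three]

/-- `det pauliPerm = 1`. -/
theorem det_pauliPerm : pauliPerm.det = 1 := by
  simp [pauliPerm, Matrix.det_fin_three]

/-! ## The first variation of a link and of the divergence defect -/

/-- **First variation of a gauge-transformed link** in Pauli coordinates: `δ(e^{X_{e₋}} U_e e^{−X_{e₊}}) = X_{e₋} U_e − U_e X_{e₊}`,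
`X_z = su2Coord (a z)`, for a site field `a : ℤ⁴ → ℝ³`. -/
def pauliLinkLin (U : LGConfig 4 SU2) (a : Site 4 → EuclideanSpace ℝ (Fin 3)) (e : ZdEdge 4) : Matrix (Fin 2) (Fin 2) ℂ :=
  su2Coord (a e.1) * (U e : Matrix (Fin 2) (Fin 2) ℂ) - (U e : Matrix (Fin 2) (Fin 2) ℂ) * su2Coord (a (e.1 + Pi.single e.2 1))

/-- **First variation of the divergence defect** `divDefect` (✓T-S5.2) along `A ↦ U^{exp iA}` at `A = 0`, in the direction of the site field `a`. -/
def divDefectLin (U : LGConfig 4 SU2) (a : Site 4 → EuclideanSpace ℝ (Fin 3)) (x : Site 4) : Fin 3 → ℝ :=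
  ∑ μ : Fin 4, (imVecM (pauliLinkLin U a (x - Pi.single μ 1, μ)) - imVecM (pauliLinkLin U a (x, μ)))

/-- Componentwise formula. -/
theorem divDefectLin_apply (U : LGConfig 4 SU2) (a : Site 4 → EuclideanSpace ℝ (Fin 3)) (x : Site 4) (c : Fin 3) :
    divDefectLin U a x c = ∑ μ : Fin 4, (imVecM (pauliLinkLin U a (x - Pi.single μ 1, μ)) c - imVecM (pauliLinkLin U a (x, μ)) c) := by
  simp only [divDefectLin, Finset.sum_apply, Pi.sub_apply]

/-- `pauliLinkLin` is additive in the field. -/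
theorem pauliLinkLin_add (U : LGConfig 4 SU2) (a b : Site 4 → EuclideanSpace ℝ (Fin 3)) (e : ZdEdge 4) :
    pauliLinkLin U (a + b) e = pauliLinkLin U a e + pauliLinkLin U b e := by
  have hadd : ∀ v w : Fin 3 → ℝ, su2Coord (v + w) = su2Coord v + su2Coord w := fun v w => by
    ext i j; fin_cases i <;> fin_cases j <;> simp [su2Coord] <;> ring
  simp only [pauliLinkLin, Pi.add_apply, WithLp.ofLp_add, hadd, add_mul, mul_add]
  abel

/-- `pauliLinkLin` is homogeneous in the field. -/
theorem pauliLinkLin_smul (U : LGConfig 4 SU2) (r : ℝ) (a : Site 4 → EuclideanSpace ℝ (Fin 3)) (e : ZdEdge 4) :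
    pauliLinkLin U (r • a) e = r • pauliLinkLin U a e := by
  have hsmul : ∀ v : Fin 3 → ℝ, su2Coord (r • v) = r • su2Coord v := fun v => by
    ext i j; fin_cases i <;> fin_cases j <;> simp [su2Coord, Complex.real_smul] <;> ring
  simp only [pauliLinkLin, Pi.smul_apply, WithLp.ofLp_smul, hsmul, smul_mul_assoc, mul_smul_comm, smul_sub]

/-- `pauliLinkLin` of the zero field vanishes. -/
theorem pauliLinkLin_zero (U : LGConfig 4 SU2) (e : ZdEdge 4) : pauliLinkLin U 0 e = 0 := by
  have hzero : su2Coord 0 = 0 := by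
    ext i j; fin_cases i <;> fin_cases j <;> simp [su2Coord]
  simp [pauliLinkLin, hzero]

/-- **`divDefectLin` is additive.** -/
theorem divDefectLin_add (U : LGConfig 4 SU2) (a b : Site 4 → EuclideanSpace ℝ (Fin 3)) (x : Site 4) :
    divDefectLin U (a + b) x = divDefectLin U a x + divDefectLin U b x := by
  simp only [divDefectLin, pauliLinkLin_add, imVecM_add, ← Finset.sum_add_distrib]
  refine Finset.sum_congr rfl fun μ _ => ?_
  abel

/-- **`divDefectLin` is homogeneous.** -/
theorem divDefectLin_smul (U : LGConfig 4 SU2) (r : ℝ) (a : Site 4 → EuclideanSpace ℝ (Fin 3)) (x : Site 4) :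
    divDefectLin U (r • a) x = r • divDefectLin U a x := by
  simp only [divDefectLin, pauliLinkLin_smul, imVecM_smul, Finset.smul_sum, smul_sub]

/-- `divDefectLin` of the zero field vanishes. -/
theorem divDefectLin_zero (U : LGConfig 4 SU2) (x : Site 4) : divDefectLin U 0 x = 0 := by
  simp [divDefectLin, pauliLinkLin_zero, imVecM_zero]

/-- `divDefectLin` over finite linear combinations. -/
theorem divDefectLin_sum_smul {ι : Type*} (s : Finset ι) (U : LGConfig 4 SU2) (r : ι → ℝ)
    (a : ι → Site 4 → EuclideanSpace ℝ (Fin 3)) (x : Site 4) :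
    divDefectLin U (∑ i ∈ s, r i • a i) x = ∑ i ∈ s, r i • divDefectLin U (a i) x := by
  classical
  induction s using Finset.induction_on with
  | empty => simp [divDefectLin_zero]
  | insert i s hi ih => rw [Finset.sum_insert hi, Finset.sum_insert hi, divDefectLin_add, divDefectLin_smul, ih]

/-! ## Interior Pauli coordinates: zero extension, coordinate vectors, the operator -/

/-- Zero extension of interior Pauli coordinates to a site field on `ℤ⁴`. -/
def extPauli (H : ℕ) (A : ↥(interiorSites H) → EuclideanSpace ℝ (Fin 3)) (z : Site 4) : EuclideanSpace ℝ (Fin 3) :=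
  if hz : z ∈ interiorSites H then A ⟨z, hz⟩ else 0

/-- `extPauli` on the interior. -/
theorem extPauli_of_mem {H : ℕ} (A : ↥(interiorSites H) → EuclideanSpace ℝ (Fin 3)) {z : Site 4} (hz : z ∈ interiorSites H) :
    extPauli H A z = A ⟨z, hz⟩ := by
  unfold extPauli; rw [dif_pos hz]

/-- `extPauli` off the interior. -/
theorem extPauli_of_not_mem {H : ℕ} (A : ↥(interiorSites H) → EuclideanSpace ℝ (Fin 3)) {z : Site 4} (hz : z ∉ interiorSites H) :
    extPauli H A z = 0 := by
  unfold extPauli; rw [dif_neg hz]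

/-- Components of `extPauli` are the tree's `zeroExtend` of the components. -/
theorem extPauli_apply_eq_zeroExtend {H : ℕ} (A : ↥(interiorSites H) → EuclideanSpace ℝ (Fin 3)) (z : Site 4) (b : Fin 3) :
    extPauli H A z b = zeroExtend (interiorSites H) (fun y => A y b) z := by
  by_cases hz : z ∈ interiorSites H
  · rw [extPauli_of_mem A hz, Literature.Probability.LatticeModels.zeroExtend_of_mem _ hz]
  · rw [extPauli_of_not_mem A hz, Literature.Probability.LatticeModels.zeroExtend_of_not_mem _ hz]; rfl

/-- `extPauli` is additive. -/
theorem extPauli_add {H : ℕ} (A B : ↥(interiorSites H) → EuclideanSpace ℝ (Fin 3)) : extPauli H (A + B) = extPauli H A + extPauli H B := by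
  funext z
  by_cases hz : z ∈ interiorSites H
  · simp only [Pi.add_apply, extPauli_of_mem _ hz]
  · simp only [Pi.add_apply, extPauli_of_not_mem _ hz, add_zero]

/-- `extPauli` is homogeneous. -/
theorem extPauli_smul {H : ℕ} (r : ℝ) (A : ↥(interiorSites H) → EuclideanSpace ℝ (Fin 3)) : extPauli H (r • A) = r • extPauli H A := by
  funext z
  by_cases hz : z ∈ interiorSites H
  · simp only [Pi.smul_apply, extPauli_of_mem _ hz]
  · simp only [Pi.smul_apply, extPauli_of_not_mem _ hz, smul_zero]

/-- **The interior gauge transformation in Pauli coordinates** is `expPauli` of the zero-extended field (T-S5.4b's `pauliGauge H A`). -/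
theorem extendGauge_expPauli {H : ℕ} (A : ↥(interiorSites H) → EuclideanSpace ℝ (Fin 3)) :
    extendGauge H (fun y => expPauli (A y)) = fun z => expPauli (extPauli H A z) := by
  funext z
  by_cases hz : z ∈ interiorSites H
  · rw [extendGauge_of_mem _ hz, extPauli_of_mem A hz]
  · rw [extendGauge_of_not_mem _ hz, extPauli_of_not_mem A hz, expPauli_zero]

/-- A coordinate vector `v : interiorSites × Fin 3 → ℝ` read as an interior field. -/
def vecToField (H : ℕ) (v : ↥(interiorSites H) × Fin 3 → ℝ) : ↥(interiorSites H) → EuclideanSpace ℝ (Fin 3) :=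
  fun y => WithLp.toLp 2 fun b => v (y, b)

/-- Components of `vecToField`. -/
@[simp] theorem vecToField_apply {H : ℕ} (v : ↥(interiorSites H) × Fin 3 → ℝ) (y : ↥(interiorSites H)) (b : Fin 3) :
    vecToField H v y b = v (y, b) := rfl

/-- `vecToField` is additive. -/
theorem vecToField_add {H : ℕ} (v w : ↥(interiorSites H) × Fin 3 → ℝ) : vecToField H (v + w) = vecToField H v + vecToField H w := by
  funext y; ext b; rfl

/-- `vecToField` is homogeneous. -/
theorem vecToField_smul {H : ℕ} (r : ℝ) (v : ↥(interiorSites H) × Fin 3 → ℝ) : vecToField H (r • v) = r • vecToField H v := by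
  funext y; ext b; rfl

/-- **The linearised Faddeev–Popov map** on coordinate vectors: `v ↦ ((x,c) ↦ divDefectLin U (ext v) x c)`. -/
def fpLinear (H : ℕ) (U : LGConfig 4 SU2) : (↥(interiorSites H) × Fin 3 → ℝ) →ₗ[ℝ] (↥(interiorSites H) × Fin 3 → ℝ) where
  toFun v p := divDefectLin U (extPauli H (vecToField H v)) p.1 p.2
  map_add' v w := by
    funext p
    rw [vecToField_add, extPauli_add, divDefectLin_add]
    rfl
  map_smul' r v := by
    funext p
    rw [vecToField_smul, extPauli_smul, divDefectLin_smul]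
    rfl

/-- Evaluation of `fpLinear`. -/
theorem fpLinear_apply {H : ℕ} (U : LGConfig 4 SU2) (v : ↥(interiorSites H) × Fin 3 → ℝ) (p : ↥(interiorSites H) × Fin 3) :
    fpLinear H U v p = divDefectLin U (extPauli H (vecToField H v)) p.1 p.2 := rfl

/-- **THE LATTICE FADDEEV–POPOV OPERATOR** of the configuration `U` on the cold box: the matrix of `fpLinear H U` in the coordinate basis
of `ℝ^{interiorSites H × 3}`. -/
def fpOperator (H : ℕ) (U : LGConfig 4 SU2) : Matrix (↥(interiorSites H) × Fin 3) (↥(interiorSites H) × Fin 3) ℝ :=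
  LinearMap.toMatrix' (fpLinear H U)

/-- **`fpOperator *ᵥ v` is the linearised divergence defect of the field `v`.** -/
theorem fpOperator_mulVec {H : ℕ} (U : LGConfig 4 SU2) (v : ↥(interiorSites H) × Fin 3 → ℝ) (p : ↥(interiorSites H) × Fin 3) :
    (fpOperator H U *ᵥ v) p = divDefectLin U (extPauli H (vecToField H v)) p.1 p.2 := by
  rw [fpOperator, LinearMap.toMatrix'_mulVec, fpLinear_apply]

/-- Entries of `fpOperator`. -/
theorem fpOperator_apply {H : ℕ} (U : LGConfig 4 SU2) (p q : ↥(interiorSites H) × Fin 3) :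
    fpOperator H U p q = divDefectLin U (extPauli H (vecToField H (Pi.single q 1))) p.1 p.2 := by
  rw [fpOperator, LinearMap.toMatrix'_apply, fpLinear_apply]

/-! ## The flat point `U = 1`: `fpOperator H 1 = −(Dirichlet Laplacian) ⊗ pauliPerm` -/

/-- At `U = 1` the link variation is `su2Coord (a e₋ − a e₊)`. -/
theorem pauliLinkLin_one (a : Site 4 → EuclideanSpace ℝ (Fin 3)) (e : ZdEdge 4) :
    pauliLinkLin 1 a e = su2Coord (a e.1 - a (e.1 + Pi.single e.2 1)) := by
  have hsub : ∀ v w : Fin 3 → ℝ, su2Coord (v - w) = su2Coord v - su2Coord w := fun v w => by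
    ext i j; fin_cases i <;> fin_cases j <;> simp [su2Coord] <;> ring
  simp only [pauliLinkLin, Pi.one_apply, OneMemClass.coe_one, mul_one, one_mul, hsub]

/-- **The flat point**: `divDefectLin 1 a x = pauliPerm *ᵥ (b ↦ Δ_{ℤ⁴} (a · b) x)` — the lattice Laplacian of the components, read through
the coordinate dictionary. -/
theorem divDefectLin_one (a : Site 4 → EuclideanSpace ℝ (Fin 3)) (x : Site 4) :
    divDefectLin 1 a x = pauliPerm *ᵥ fun b => latticeLaplacianZd (fun z => a z b) x := by
  have hlin : ∀ v w : Fin 3 → ℝ, pauliPerm *ᵥ v - pauliPerm *ᵥ w = pauliPerm *ᵥ (v - w) := fun v w => by rw [Matrix.mulVec_sub]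
  simp only [divDefectLin, pauliLinkLin_one, imVecM_su2Coord, hlin, ← Matrix.mulVec_sum]
  congr 1
  funext b
  simp only [Finset.sum_apply, Pi.sub_apply, sub_add_cancel, Literature.Probability.LatticeModels.latticeLaplacianZd,
    Finset.sum_sub_distrib, Finset.sum_add_distrib, Finset.sum_const, Finset.card_univ, Fintype.card_fin]
  push_cast
  ring

/-- **`fpOperator H 1 = −(dirichletMatrix (interiorSites H) ⊗ₖ pauliPerm)`**: at the flat configuration the Faddeev–Popov operator is minus
the Dirichlet Laplacian matrix of the interior box (✓`dirichletMatrix`: `8` on the diagonal, `−1` on lattice neighbours) tensor the coordinate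
dictionary. -/
theorem fpOperator_one (H : ℕ) : fpOperator H 1 = -(dirichletMatrix (interiorSites H) ⊗ₖ pauliPerm) := by
  ext p q
  rw [fpOperator_apply, divDefectLin_one, Matrix.neg_apply, Matrix.kroneckerMap_apply]
  -- the components of the zero-extended basis field are `zeroExtend` of coordinate indicators
  have hcomp : ∀ b : Fin 3, (fun z => extPauli H (vecToField H (Pi.single q (1 : ℝ))) z b) =
      zeroExtend (interiorSites H) (fun y => if b = q.2 then (Pi.single q.1 (1 : ℝ) : ↥(interiorSites H) → ℝ) y else 0) := by
    intro b
    funext z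
    rw [extPauli_apply_eq_zeroExtend]
    congr 1
    funext y
    simp only [vecToField_apply, Pi.single_apply]
    by_cases hb : b = q.2
    · subst hb
      by_cases hy : y = q.1
      · subst hy; simp
      · have : (y, q.2) ≠ q := fun h => hy (congrArg Prod.fst h)
        simp [hy, this]
    · have : (y, b) ≠ q := fun h => hb (congrArg Prod.snd h)
      simp [hb, this]
  have hlap : ∀ b : Fin 3, latticeLaplacianZd (fun z => extPauli H (vecToField H (Pi.single q (1 : ℝ))) z b) p.1 =
      -(if b = q.2 then dirichletMatrix (interiorSites H) p.1 q.1 else 0) := by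
    intro b
    rw [hcomp b, ← neg_neg (latticeLaplacianZd _ _), ← mulVec_dirichletMatrix]
    congr 1
    by_cases hb : b = q.2
    · simp only [hb, if_true]
      rw [show (fun y => (Pi.single q.1 (1 : ℝ) : ↥(interiorSites H) → ℝ) y) = Pi.single q.1 1 from rfl, Matrix.mulVec_single,
        MulOpposite.op_one, one_smul]
      rfl
    · simp only [hb, if_false]
      rw [show (fun _ : ↥(interiorSites H) => (0 : ℝ)) = 0 from rfl, Matrix.mulVec_zero, Pi.zero_apply]
  simp only [hlap, Matrix.mulVec, dotProduct, mul_neg, Finset.sum_neg_distrib, mul_ite, mul_zero, Finset.sum_ite_eq',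
    Finset.mem_univ, if_true]
  ring

/-- **`|det (fpOperator H 1)| = |det (dirichletMatrix (interiorSites H))|³`** (`det (A ⊗ₖ B) = det A ^ 3 · det B ^ |I|`, `det pauliPerm = 1`). -/
theorem abs_det_fpOperator_one (H : ℕ) : |(fpOperator H 1).det| = |(dirichletMatrix (interiorSites H)).det| ^ 3 := by
  rw [fpOperator_one, Matrix.det_neg, Matrix.det_kronecker, det_pauliPerm, one_pow, mul_one, Fintype.card_fin, abs_mul, abs_pow,
    abs_pow, abs_neg, abs_one, one_pow, one_mul]

/-- The flat Faddeev–Popov operator is invertible: `det (fpOperator H 1) ≠ 0` (the Dirichlet Laplacian matrix is injective,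
✓`mulVec_dirichletMatrix_injective`). -/
theorem det_fpOperator_one_ne_zero (H : ℕ) : (fpOperator H 1).det ≠ 0 := by
  have hD : (dirichletMatrix (interiorSites H)).det ≠ 0 := by
    intro h0
    obtain ⟨v, hv0, hv⟩ := Matrix.exists_mulVec_eq_zero_iff.2 h0
    exact hv0 (Literature.Probability.LatticeModels.mulVec_dirichletMatrix_injective (by norm_num) (interiorSites H)
      (hv.trans (Matrix.mulVec_zero _).symm))
  intro h
  have h1 := abs_det_fpOperator_one H
  rw [h, abs_zero] at h1
  exact pow_ne_zero 3 (abs_ne_zero.2 hD) h1.symm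

/-! ## Appendix (same seat, appended): `pauliPerm` is a symmetric involution, so `FᵀF = Δ_I² ⊗ 1₃` at the flat point -/

/-- `pauliPerm` is symmetric. -/
theorem pauliPerm_transpose : pauliPermᵀ = pauliPerm := by
  ext i j
  fin_cases i <;> fin_cases j <;> rfl

/-- `pauliPerm` is an involution: `pauliPerm * pauliPerm = 1`. -/
theorem pauliPerm_mul_self : pauliPerm * pauliPerm = 1 := by
  ext i j
  fin_cases i <;> fin_cases j <;> simp [pauliPerm, Matrix.mul_apply, Fin.sum_univ_three]

/-- **`(fpOperator H 1)ᵀ · fpOperator H 1 = (Δ_I · Δ_I) ⊗ₖ 1₃`** (planner ym-idea-2 g17, 17:30:23Z (c)): the coordinate dictionary drops out of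
`FᵀF`, so λ_min-floors and traces of `dirichletMatrix (interiorSites H)` transfer verbatim. -/
theorem fpOperator_one_transpose_mul_self (H : ℕ) :
    (fpOperator H 1)ᵀ * fpOperator H 1 =
      (dirichletMatrix (interiorSites H) * dirichletMatrix (interiorSites H)) ⊗ₖ (1 : Matrix (Fin 3) (Fin 3) ℝ) := by
  rw [fpOperator_one, Matrix.transpose_neg, ← Matrix.kroneckerMap_transpose, neg_mul_neg,
    Literature.Probability.LatticeModels.dirichletMatrix_transpose, pauliPerm_transpose, ← pauliPerm_mul_self, Matrix.mul_kronecker_mul]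

/-- Quadratic-form version: `‖fpOperator H 1 v‖² = ‖(Δ_I ⊗ₖ 1₃) v‖²` for every `v`. -/
theorem fpOperator_one_normSq_eq (H : ℕ) (v : ↥(interiorSites H) × Fin 3 → ℝ) :
    (fpOperator H 1 *ᵥ v) ⬝ᵥ (fpOperator H 1 *ᵥ v) =
      ((dirichletMatrix (interiorSites H) ⊗ₖ (1 : Matrix (Fin 3) (Fin 3) ℝ)) *ᵥ v) ⬝ᵥ
        ((dirichletMatrix (interiorSites H) ⊗ₖ (1 : Matrix (Fin 3) (Fin 3) ℝ)) *ᵥ v) := by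
  have key : ∀ M : Matrix (↥(interiorSites H) × Fin 3) (↥(interiorSites H) × Fin 3) ℝ,
      v ⬝ᵥ ((Mᵀ * M) *ᵥ v) = (M *ᵥ v) ⬝ᵥ (M *ᵥ v) := fun M => by
    rw [← Matrix.mulVec_mulVec, Matrix.dotProduct_mulVec, Matrix.vecMul_transpose]
  rw [← key, ← key, fpOperator_one_transpose_mul_self, ← Matrix.kroneckerMap_transpose, Matrix.transpose_one,
    Literature.Probability.LatticeModels.dirichletMatrix_transpose, ← Matrix.mul_kronecker_mul, Matrix.mul_one]

end Summit.QuantumFields.YangMills.Theorems.AllWindowsColdBoxBoxHighLine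

end
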